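import Summits.Ventures.Crystal3D.Bulk.ClosePackedWitness
import HarnessLib

/-!
# Non-vacuity of the hypothesis of `L12Local`: a saturated ball with twelve saturated neighbours

HONEST FRAMING. Part of the venture `Summits/Ventures/Crystal3D` (cell `pub-crystal3d`, phase 2),
companion of `Bulk/LocalTwelve.lean` and `Bulk/ClosePackedWitness.lean`; red-team item R39 (e):
the HYPOTHESIS of the local lemma `L12Local` ("ball `i` has twelve contacts and so does each of
its twelve contact neighbours") is INSTANTIABLE in a finite packing — so `L12Local` is not
vacuously true — and on the instance its CONCLUSION holds (the shell is the FCC pattern), an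
unconditional positive control. The instance is the cell red team's exact witness (red, RED-TEAM.md
R-2): the `55` sites of the face-centred cubic lattice `D₃ = {v ∈ ℤ³ : v₀ + v₁ + v₂ even}`
with `|v|² ≤ 8` (shells of squared radius `0, 2, 4, 6, 8` with `1 + 12 + 6 + 24 + 12` sites), at
contact distance `1` (scale `1/√2`): the centre and each of its twelve neighbours have exactly
twelve contacts inside the cluster. Kernel integer arithmetic only; nothing else is claimed.
-/

noncomputable section

open scoped BigOperators
open Finset

namespace Summit.Ventures.Crystal3D

open Literature.Geometry.DiscreteGeometry (fccKissingPattern fccInt intVec sqNormInt scaledPattern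
  isArrangedIn_self)
open Literature.Barriers.AtomisticToContinuum (intConfig)

variable {N : ℕ}

/-- Coordination numbers in integer models: the number of labels at integer squared distance
exactly `m` (kernel arithmetic). -/
theorem coordination_intConfig (c : Fin N → Fin 3 → ℤ) {m : ℕ} (hm : 0 < m) (i : Fin N) :
    coordination (intConfig c (1 / Real.sqrt m)) i =
      (univ.filter fun j => j ≠ i ∧ sqNormInt (c i - c j) = m).card := by
  rw [coordination]
  congr 1
  ext j
  rw [mem_contactNeighbors_intConfig c hm, mem_filter]
  simp

/-! ## The 55-site fcc cluster -/

/-- The `55` sites of the fcc lattice `D₃` of squared norm `≤ 8` (integer model, contact at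
squared distance `2`): label `0` the centre, labels `1`–`12` its twelve neighbours (the minimal
vectors `fccInt` in the tree's order), then the shells of squared radius `4, 6, 8`. -/
def fcc55Int : Fin 55 → Fin 3 → ℤ :=
  ![![0, 0, 0], ![1, 1, 0], ![1, -1, 0], ![-1, 1, 0],
    ![-1, -1, 0], ![1, 0, 1], ![1, 0, -1], ![-1, 0, 1],
    ![-1, 0, -1], ![0, 1, 1], ![0, 1, -1], ![0, -1, 1],
    ![0, -1, -1], ![-2, 0, 0], ![0, -2, 0], ![0, 0, -2],
    ![0, 0, 2], ![0, 2, 0], ![2, 0, 0], ![-2, -1, -1],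
    ![-2, -1, 1], ![-2, 1, -1], ![-2, 1, 1], ![-1, -2, -1],
    ![-1, -2, 1], ![-1, -1, -2], ![-1, -1, 2], ![-1, 1, -2],
    ![-1, 1, 2], ![-1, 2, -1], ![-1, 2, 1], ![1, -2, -1],
    ![1, -2, 1], ![1, -1, -2], ![1, -1, 2], ![1, 1, -2],
    ![1, 1, 2], ![1, 2, -1], ![1, 2, 1], ![2, -1, -1],
    ![2, -1, 1], ![2, 1, -1], ![2, 1, 1], ![-2, -2, 0],
    ![-2, 0, -2], ![-2, 0, 2], ![-2, 2, 0], ![0, -2, -2],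
    ![0, -2, 2], ![0, 2, -2], ![0, 2, 2], ![2, -2, 0],
    ![2, 0, -2], ![2, 0, 2], ![2, 2, 0]]

/-- Distinct sites are at squared distance `≥ 2` (kernel check over all pairs). -/
theorem sep_fcc55 :
    ∀ i j : Fin 55, i ≠ j → (2 : ℤ) ≤ sqNormInt (fcc55Int i - fcc55Int j) := by
  decide +kernel

/-- The cluster at scale `1/√2` is a packing of unit-diameter balls. -/
theorem isUnitPacking_fcc55 : IsUnitPacking (intConfig fcc55Int (1 / Real.sqrt (2 : ℕ))) :=
  isUnitPacking_intConfig _ (by norm_num) sep_fcc55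

/-- The centre and every site touching it have exactly twelve contacts inside the cluster (kernel
check). -/
theorem card_contacts_fcc55 :
    ∀ i : Fin 55, (i = 0 ∨ sqNormInt (fcc55Int 0 - fcc55Int i) = 2) →
      (univ.filter fun j => j ≠ i ∧ sqNormInt (fcc55Int i - fcc55Int j) = (2 : ℕ)).card = 12 :=
  by decide +kernel

/-- The centre has twelve contacts. -/
theorem coordination_fcc55_centre :
    coordination (intConfig fcc55Int (1 / Real.sqrt (2 : ℕ))) 0 = 12 := by
  rw [coordination_intConfig _ (by norm_num)]
  exact card_contacts_fcc55 0 (Or.inl rfl)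

/-- Each contact neighbour of the centre has twelve contacts. -/
theorem coordination_fcc55_neighbours :
    ∀ j ∈ contactNeighbors (intConfig fcc55Int (1 / Real.sqrt (2 : ℕ))) 0,
      coordination (intConfig fcc55Int (1 / Real.sqrt (2 : ℕ))) j = 12 := by
  intro j hj
  rw [mem_contactNeighbors_intConfig _ (by norm_num)] at hj
  rw [coordination_intConfig _ (by norm_num)]
  exact card_contacts_fcc55 j (Or.inr (by exact_mod_cast hj.2))

/-- **Non-vacuity of the hypothesis of `L12Local`**: there is a finite packing of unit-diameter
balls in `ℝ³` with a ball that has twelve contacts each of whose contact neighbours has twelve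
contacts. -/
theorem exists_saturated_with_saturated_neighbours :
    ∃ (N : ℕ) (x : Fin N → EuclideanSpace ℝ (Fin 3)) (i : Fin N), IsUnitPacking x ∧
      coordination x i = 12 ∧ ∀ j ∈ contactNeighbors x i, coordination x j = 12 :=
  ⟨55, _, 0, isUnitPacking_fcc55, coordination_fcc55_centre, coordination_fcc55_neighbours⟩

/-! ## The conclusion of `L12Local` on the instance (unconditional positive control) -/

/-- The sites touching the centre are exactly the labels `1`–`12`, whose vectors are the fcc
minimal vectors `fccInt` (kernel check). -/
theorem image_contacts_fcc55_centre :
    (univ.filter fun j : Fin 55 =>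
      j ≠ 0 ∧ sqNormInt (fcc55Int 0 - fcc55Int j) = (2 : ℕ)).image fcc55Int = fccInt := by
  decide +kernel

/-- The centre of the model is the origin. -/
theorem fcc55_centre_eq_zero : intConfig fcc55Int (1 / Real.sqrt (2 : ℕ)) 0 = 0 := by
  have h : fcc55Int 0 = 0 := by decide +kernel
  ext k
  simp [intConfig, h, intVec]

/-- The contact neighbours of the centre, as the kernel-decidable filter. -/
theorem contactNeighbors_fcc55_centre :
    contactNeighbors (intConfig fcc55Int (1 / Real.sqrt (2 : ℕ))) 0 =
      univ.filter fun j : Fin 55 =>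
        j ≠ 0 ∧ sqNormInt (fcc55Int 0 - fcc55Int j) = (2 : ℕ) := by
  ext j
  rw [mem_contactNeighbors_intConfig _ (by norm_num), mem_filter]
  simp

/-- **The contact shell of the centre is the doubled FCC pattern.** -/
theorem contactShell_fcc55_centre :
    contactShell (intConfig fcc55Int (1 / Real.sqrt (2 : ℕ))) 0 =
      (fun p => (2 : ℝ) • p) '' (fccKissingPattern : Set (EuclideanSpace ℝ (Fin 3))) := by
  rw [contactShell, contactNeighbors_fcc55_centre, fcc55_centre_eq_zero, fccKissingPattern,
    scaledPattern, ← image_contacts_fcc55_centre, coe_image, coe_image, Set.image_image,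
    Set.image_image]
  refine Set.image_congr' fun j => ?_
  simp only [sub_zero, intConfig, one_div, smul_smul]

/-- **The conclusion of `L12Local` holds on the witness**: the centre of the 55-site cluster — a
saturated ball with saturated neighbours — has a close-packed (FCC) first shell. -/
theorem isClosePackedShell_fcc55_centre :
    IsClosePackedShell (intConfig fcc55Int (1 / Real.sqrt (2 : ℕ))) 0 := by
  left
  rw [contactShell_fcc55_centre]
  exact isArrangedIn_self fccKissingPattern

end Summit.Ventures.Crystal3D

end
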